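import Literature.AnabelianGeometry.AbsoluteAnabelian.HolomorphicEllipticCuspidalization
import Literature.Topology.CoveringSpaces.PuncturedDiscSections
import Literature.Topology.CoveringSpaces.AbelianDeckMonodromy
import Literature.Topology.CoveringSpaces.PunctureFill
import HarnessLib

/-!
# [AbsTopIII] Cor 2.7 (b).7 `AbelianCoverOfPuncturedTorusExtends` — ASSEMBLY modulo the commutator loop

Proof-only companion (abc-iut cell, SUBDAG Cor-27 row Cor-27.b.r10, seat abc-iut-L4-t8; holder's plan
F1–F4 of 2026-08-26) of `HolomorphicEllipticCuspidalization.lean` (p414370, seat abc-iut-L4-t12), which it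
imports unchanged.  S. Mochizuki, *Topics in Absolute Anabelian Geometry III*, Cor 2.7 (b) p.59: "`U → E` is
an abelian finite étale covering [which necessarily extends to a covering of the one-point compactification
of `E^top`]" [cite: MochizukiAbsTopIII2015, Corollary 2.7 (b) p.59].  The typed sub-node (b).7 asks: a
finite étale covering `q : Y → 𝔼` of the once-punctured complex torus `𝔼 = T ∖ {0}` whose deck group is
commutative and transitive on fibres extends to a finite covering of `T`, `Y` being the preimage of `𝔼`.

This file is the ASSEMBLY (piece F4): it proves (b).7 from ONE remaining topological input, stated as the
hypothesis `hF3` (piece F3b, the torus side of "the loop around the puncture is a commutator in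
`π₁(𝔼) ≅ F₂`"): for every period isomorphism `Φ` there are a pointed chart `ψ` of a punctured
neighbourhood of `0 ∈ T` (continuous, injective and open on a disc `ball 0 r`, `ψ 0 = 0`) and a winding
loop `γ : t ↦ ψ(s e^{i(θ₀+2πt)})` in `𝔼` whose class lies in the commutator subgroup of `π₁(𝔼, γ 0)`.
Route: F1 `AbelianDeck.liftPath_one_eq_of_mem_commutator` (w5-d144; abelian + transitive deck group ⇒
the monodromy kills commutators ⇒ `γ` lifts to CLOSED paths) → F2
`exists_puncture_sheets_of_liftPath` (`PuncturedDiscSections`; closed lifts of the winding loop ⇒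
`q⁻¹` of the punctured chart neighbourhood is a disjoint union of sheets mapped bijectively) →
`PunctureFill.isCoveringMap_proj` (adjoin one point per sheet ⇒ a covering of `T`; fibre over `0` = the
sheets, finite since they are indexed by a fibre of `q`; `inl` an open embedding with range the preimage
of `𝔼`).  The degenerate case of no sheet (then `q` misses the whole chart neighbourhood and `Y` itself,
with `Subtype.val ∘ q`, is the extension) is included.

* `HolomorphicEllipticCuspidalization.abelianCoverOfPuncturedTorusExtends_of_commutatorLoop` —
  `hF3 → AbelianCoverOfPuncturedTorusExtends` (FQ conclusion; proof-only, no definitions).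

HONEST FRAMING: a topological reduction inside OUR typing of a refereed statement; the unconditional
closer is this theorem applied to F3b once it lands; nothing here bears on [IUTchIII] Cor. 3.12.
-/

noncomputable section

open Complex hiding I
open Set Filter Topology Function unitInterval
open Literature.Geometry.Kaehler (ComplexTorus)
open Literature.Topology.CoveringSpaces

namespace Literature.AnabelianGeometry.AbsoluteAnabelian

namespace HolomorphicEllipticCuspidalization

/-- **(b).7 from the commutator loop** (assembly): if for every complex torus the winding loop of some
pointed chart at `0` is a product of commutators in `π₁` of the punctured torus, then every finite étale
covering of the punctured torus with abelian, fibre-transitive deck group extends to a finite covering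
of the torus. [cite: MochizukiAbsTopIII2015, Corollary 2.7 (b) p.59] -/
theorem abelianCoverOfPuncturedTorusExtends_of_commutatorLoop
    (hF3 : ∀ (ι : Type) [Fintype ι] (Φ : (ι → ℝ) ≃L[ℝ] ℂ),
      ∃ (ψ : ℂ → ComplexTorus Φ) (r s θ₀ : ℝ) (b : ↥(puncturedTorus Φ)) (γ : Path b b),
        0 < r ∧ ψ 0 = 0 ∧ ContinuousOn ψ (Metric.ball 0 r) ∧ InjOn ψ (Metric.ball 0 r) ∧
        (∀ O : Set ℂ, IsOpen O → O ⊆ Metric.ball 0 r → IsOpen (ψ '' O)) ∧ 0 < s ∧ s < r ∧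
        (∀ t : I, (γ t : ComplexTorus Φ) =
          ψ ((s : ℂ) * exp (((θ₀ + 2 * Real.pi * (t : ℝ) : ℝ) : ℂ) * Complex.I))) ∧
        FundamentalGroup.fromPath (Path.Homotopic.Quotient.mk γ) ∈
          commutator (FundamentalGroup ↥(puncturedTorus Φ) b)) :
    AbelianCoverOfPuncturedTorusExtends := by
  intro ι _ Φ Y _ q hq hcomm htrans
  obtain ⟨ψ, r, s, θ₀, b, γ, hr, hψ₀, hψc, hψi, hψo, hs, hsr, hγ, hγcomm⟩ := hF3 ι Φ
  -- the map to the (unpunctured) torus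
  set p : Y → ComplexTorus Φ := Subtype.val ∘ q with hpdef
  have hp : Continuous p := continuous_subtype_val.comp hq.isCoveringMap.continuous
  have hx : ∀ y, p y ≠ 0 := fun y ↦ (q y).2
  have hS : IsOpen ((puncturedTorus Φ : Set (ComplexTorus Φ))) := (puncturedTorus Φ).isOpen
  have hcovOn : IsCoveringMapOn p {(0 : ComplexTorus Φ)}ᶜ := fun x hxx ↦
    ((hq.isCoveringMap ⟨x, hxx⟩).subtypeVal_comp _ hS).to_isEvenlyCovered_preimage
  -- F1: the winding loop has closed lifts (abelian, transitive deck group; commutator class)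
  have hlift : ∀ (e : Y) (he : γ 0 = q e), hq.isCoveringMap.liftPath γ e he 1 = e := by
    intro e he
    have he' : q e = b := by rw [← he, γ.source]
    exact AbelianDeck.liftPath_one_eq_of_mem_commutator hq.isCoveringMap (H := deckGroup q)
      (fun φ y ↦ φ.2 y) hcomm (x := b) (fun e₁ e₂ h₁ h₂ ↦ htrans e₁ e₂ (h₁.trans h₂.symm))
      γ hγcomm e he'
  -- F2: the sheets over the punctured chart neighbourhood
  have hWS : (ψ '' Metric.ball 0 r) \ {(0 : ComplexTorus Φ)} ⊆ (puncturedTorus Φ : Set (ComplexTorus Φ)) :=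
    fun x hxW ↦ hxW.2
  obtain ⟨U, hUo, hUd, hUimg, hUinj, hUmem, hUexh⟩ :=
    exists_puncture_sheets_of_liftPath (S := (puncturedTorus Φ : Set (ComplexTorus Φ))) hS
      hq.isCoveringMap hr hψ₀ hψc hψi hψo hWS hs hsr θ₀ γ hγ hlift
  -- the chart neighbourhood `W`
  have hWo : IsOpen (ψ '' Metric.ball 0 r) := hψo _ Metric.isOpen_ball Subset.rfl
  have h0W : (0 : ComplexTorus Φ) ∈ ψ '' Metric.ball 0 r := ⟨0, Metric.mem_ball_self hr, hψ₀⟩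
  have hexh : p ⁻¹' (ψ '' Metric.ball 0 r) ⊆ ⋃ e, U e := fun y hy ↦ hUexh ⟨hy, hx y⟩
  -- the index of the sheets (a fibre of `q`) is finite
  haveI hfin : Finite ↥(p ⁻¹' {ψ (↑s * exp (↑θ₀ * Complex.I))}) := by
    have hsub : p ⁻¹' {ψ (↑s * exp (↑θ₀ * Complex.I))} ⊆ q ⁻¹' {b} := by
      intro y hy
      have hy' : (q y : ComplexTorus Φ) = ψ (↑s * exp (↑θ₀ * Complex.I)) := hy
      have hb' : (b : ComplexTorus Φ) = ψ (↑s * exp (↑θ₀ * Complex.I)) := by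
        rw [← γ.source, hγ 0]
        simp
      exact Subtype.ext (hy'.trans hb'.symm)
    exact ((hq.finite_fibre b).subset hsub).to_subtype
  rcases isEmpty_or_nonempty ↥(p ⁻¹' {ψ (↑s * exp (↑θ₀ * Complex.I))}) with hemp | hne
  · /- no sheet: `p` misses the whole chart neighbourhood, so `p` itself is already a covering of `T` -/
    have hpre : p ⁻¹' (ψ '' Metric.ball 0 r) = ∅ := by
      refine eq_empty_of_forall_notMem fun y hy ↦ ?_
      obtain ⟨e, -⟩ := mem_iUnion.1 (hexh hy)
      exact hemp.false e
    refine ⟨Y, inferInstance, p, id, ?_, ?_, IsOpenEmbedding.id, fun y ↦ rfl, ?_⟩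
    · intro x
      by_cases hx0 : x = 0
      · subst hx0
        haveI : IsEmpty ↥(p ⁻¹' {(0 : ComplexTorus Φ)}) :=
          ⟨fun y ↦ hx y.1 y.2⟩
        exact IsEvenlyCovered.of_preimage_eq_empty _ (hWo.mem_nhds h0W) hpre
      · exact hcovOn x hx0
    · intro t
      by_cases ht0 : t = 0
      · subst ht0
        have : p ⁻¹' {(0 : ComplexTorus Φ)} = ∅ := eq_empty_of_forall_notMem fun y hy ↦ hx y hy
        rw [this]
        exact finite_empty
      · have : p ⁻¹' {t} = q ⁻¹' {⟨t, ht0⟩} := by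
          ext y
          simp only [mem_preimage, mem_singleton_iff, hpdef, Function.comp_apply]
          exact ⟨fun h ↦ Subtype.ext h, fun h ↦ congr_arg Subtype.val h⟩
        rw [this]
        exact hq.finite_fibre _
    · rw [Set.range_id]
      ext y
      exact ⟨fun _ ↦ (q y).2, fun _ ↦ trivial⟩
  · /- fill the puncture with one point per sheet -/
    refine ⟨PunctureFill p 0 U, inferInstance, PunctureFill.proj p 0 U, PunctureFill.inl p 0 U,
      PunctureFill.isCoveringMap_proj hx hcovOn hUo hUd hWo h0W hUimg hUinj hexh, ?_,
      PunctureFill.isOpenEmbedding_inl hp hUo, fun y ↦ rfl, ?_⟩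
    · intro t
      have hsub : PunctureFill.proj p 0 U ⁻¹' {t} ⊆
          PunctureFill.inl p 0 U '' (p ⁻¹' {t}) ∪ range (PunctureFill.inr p 0 U) := by
        intro z hz
        rcases PunctureFill.inl_or_inr p 0 U z with ⟨y, rfl⟩ | ⟨i, rfl⟩
        · exact Or.inl ⟨y, hz, rfl⟩
        · exact Or.inr ⟨i, rfl⟩
      refine Finite.subset (Finite.union ?_ (finite_range _)) hsub
      refine Finite.image _ ?_
      by_cases ht0 : t = 0
      · subst ht0
        have : p ⁻¹' {(0 : ComplexTorus Φ)} = ∅ := eq_empty_of_forall_notMem fun y hy ↦ hx y hy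
        rw [this]
        exact finite_empty
      · have : p ⁻¹' {t} = q ⁻¹' {⟨t, ht0⟩} := by
          ext y
          simp only [mem_preimage, mem_singleton_iff, hpdef, Function.comp_apply]
          exact ⟨fun h ↦ Subtype.ext h, fun h ↦ congr_arg Subtype.val h⟩
        rw [this]
        exact hq.finite_fibre _
    · rw [PunctureFill.range_inl (p := p) (x₀ := 0) (U := U) hx]
      rfl

end HolomorphicEllipticCuspidalization

end Literature.AnabelianGeometry.AbsoluteAnabelian
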